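import Summits.Schanuel.Schanuel.Theorems.DiophantineDichotomyKhovanskiiApproxTypeLWLayer
import Summits.Schanuel.Schanuel.Theorems.EPiSimultaneousType.Negative.IrreducibleWitness

/-!
# `EPiSimultaneousType` from a pair measure and two slot floors; the bounded-index core
(line `bounded-index-core` of crux stmt-Schanuel-6118, route `DiophantineDichotomy`; `--supports`)

The CLOSED part of the registered skeleton `Cruxes/EPiSimultaneousType/Lines/bounded-index-core.lean`,
landed def-free over the parent line's vocabulary `Theorems/DiophantineDichotomyDefs.lean`
(`CodimOneMeasure`, `SlotFloor`, `PrimitiveApproxMeasure`, `CodimOneTransfer` — the latter a THEOREM,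
`LwSmallHeight.codimOneTransfer_holds` of `…KhovanskiiApproxTypeLWLayer.lean`), so that the crux
`Summit.Schanuel.Schanuel.Theses.DiophantineDichotomy.EPiSimultaneousType` is concluded BY NAME from named
hypotheses:
* `epiSimultaneousType_of_primitiveApproxMeasure_of_slotFloors`: a primitive approximation measure at
  `θ = (π, e)` with exponents `(p, q)` plus slot floors with degree exponent `A` at `π` and at `e` give
  the crux with `a = A·p/(A+1)` as soon as `A·p < A + 1` (slot dichotomy at `d^τ`, `τ = p/(A+1)`: the
  parent's `slot_repulsion` / `bookkeeping_one` / `bookkeeping_two`, transplanted from `ℂ⁴` to `ℂ²`).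
* `epiSimultaneousType_of_codimOneMeasure_of_slotFloors`: the same from a decoupled codimension-one
  measure of algebraic independence of `(π, e)` with total-degree exponent `μ` (`p = (μ+1)/2`):
  condition `A(μ − 1) < 2`; `epiSimultaneousType_of_optimalPair_of_eSaving`: the other end of the
  exchange curve (`μ = 2 + o(1)` needs only SOME `A < 2` at `e`).
* `epiSimultaneousType_of_inputs` (REGISTERED on the item): the line's composition — (pair measure with
  SOME `μ < 3`) → (floors at `e` for every `A > 1`) → (floors at `π` for every `A > 1`) → crux, with
  `A = 1 + (3 − μ)/4`. Its hypotheses are exactly the registered stubs `stub_pairMeasure` (OPEN: a measure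
  of algebraic independence of `π` and `e`), `stub_eFloor` (OPEN for `1 < A < 2`; in print only `A = 2`,
  Nesterenko–Waldschmidt 1996 Thm 4(2), tree `NesterenkoWaldschmidt1996_thm_4_2`) and `stub_piFloor`
  (KNOWN: ibid. Thm 2(2), tree `NesterenkoWaldschmidt1996_thm_2_2` + `PiFloor.slotFloor_pi_of_…`).
* `core_of_primitiveApproxMeasure` / `core_of_codimOneMeasure`: on challengers of ENTANGLEMENT INDEX
  `≤ M` (`[ℚ(γ):ℚ] ≤ M·[ℚ(γᵢ):ℚ]` for both `i`) the pair measure ALONE gives the crux inequality with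
  exchange rate `a = p − 1 = (μ − 1)/2`, for every `M ≥ 1` — the population the route's race meets.
* `slotFloor_expOne_of_lwSmallHeight_one`: the parent line's `LWSmallHeight 1` implies the `e`-floor.
Nothing is asserted: every theorem is a conditional reduction with its inputs as hypotheses; no `def`.
Disproof consistency (`Cruxes/EPiSimultaneousType/Disproof.lean` v2): Dirichlet forces `μ ≥ 2`, `A ≥ 1`,
so the outputs have `a ≥ 1/2` (core) and `a ≥ 3/4` (full crux), inside the open window `[1/2, 1)`.
-/

set_option linter.dupNamespace false

noncomputable section

open Polynomial
open scoped IntermediateField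

namespace Summit.Schanuel.Schanuel.Theorems

open Summit.Schanuel.Schanuel.Theses.DiophantineDichotomy (EPiSimultaneousType)
open Summit.Schanuel.Schanuel.Cruxes.KhovanskiiApproxType.LwSmallHeight

namespace EPiSimultaneousType.BoundedIndexCore

/-- A decoupled codimension-one measure with exponents `(μ, K)` at `(π, e)` gives the primitive
approximation measure with `p = (μ+1)/2` and some `q ≥ 0`. [folklore] -/
theorem primitive_of_codimOneMeasure {μ K C : ℝ} (hμ : 0 ≤ μ) (hK : 0 ≤ K)
    (h : CodimOneMeasure 2 ![(Real.pi : ℂ), (Real.exp 1 : ℂ)] μ K C) :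
    ∃ q C' : ℝ, 0 ≤ q ∧ PrimitiveApproxMeasure 2 ![(Real.pi : ℂ), (Real.exp 1 : ℂ)] ((μ + 1) / 2) q C' := by
  obtain ⟨C', hP⟩ := codimOneTransfer_holds 2 ![(Real.pi : ℂ), (Real.exp 1 : ℂ)] μ K C (by norm_num) hμ hK h
  refine ⟨(max μ K + 1) / (2 : ℕ) + 1, C', ?_, ?_⟩
  · have : (0 : ℝ) ≤ max μ K := hμ.trans (le_max_left _ _)
    positivity
  · have h2 : ((μ + 1) / 2 : ℝ) = (μ + 1) / (2 : ℕ) := by norm_num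
    rw [h2]
    exact hP

/-- Monotonicity of a codimension-one measure in its degree exponent. [folklore] -/
theorem codimOneMeasure_mono_exponent {m : ℕ} {ω : Fin m → ℂ} {μ μ' K C : ℝ} (hμ : μ ≤ μ')
    (h : CodimOneMeasure m ω μ K C) : CodimOneMeasure m ω μ' K C := by
  refine ⟨h.1, fun P hP => le_trans ?_ (h.2 P hP)⟩
  apply Real.exp_le_exp.2
  apply neg_le_neg
  have h1 : (1 : ℝ) ≤ max 1 (P.totalDegree : ℝ) := le_max_left _ _
  have hlog : 0 ≤ Real.log (max 1 (mvNatHeight P : ℝ)) := Real.log_nonneg (le_max_left _ _)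
  have hpow : (max 1 (P.totalDegree : ℝ)) ^ μ ≤ (max 1 (P.totalDegree : ℝ)) ^ μ' :=
    Real.rpow_le_rpow_of_exponent_le h1 hμ
  have hC : 0 ≤ C := h.1.le
  gcongr

/-- BRIDGE between the two lines' open inputs: the parent line's registered `LWSmallHeight 1`
(small-height Lindemann–Weierstrass in one variable, exponent `1`, polynomial penalty, at every `e^β`)
gives the slot floor at `e` for every `A ≥ 1` (take `β = 1`, weaken `1 ↦ A`). [folklore] -/
theorem slotFloor_expOne_of_lwSmallHeight_one (h : LWSmallHeight 1) {A : ℝ} (hA : 1 ≤ A) :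
    ∃ K C : ℝ, SlotFloor (Real.exp 1 : ℂ) A K C := by
  obtain ⟨K, C, -, hKC⟩ := h (fun _ => (1 : ℂ)) (fun _ => isAlgebraic_one)
    (linearIndependent_unique_iff.mpr one_ne_zero)
  have hfun : (Complex.exp ∘ fun _ : Fin 1 => (1 : ℂ)) = fun _ : Fin 1 => ((Real.exp 1 : ℝ) : ℂ) := by
    funext i
    simp [Complex.ofReal_exp]
  rw [hfun] at hKC
  refine ⟨K, C, ?_⟩
  have hA' : ((1 : ℕ) : ℝ) ≤ A := by push_cast; exact hA
  exact codimOneMeasure_mono_exponent hA' hKC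

/-- **Primitive pair measure + floors ⟹ `EPiSimultaneousType`.** At `θ = (π, e)`, a primitive
approximation measure with exponents `(p, q)` plus slot floors with degree exponent `A` at both
coordinates give the crux with `a = A·p/(A+1) < 1` provided `A·p < A + 1`; `b = a + |q| + τK⁺ + 3`,
`τ = p/(A+1)`, `C' = 3(C + C₀ + C₁) + 5 + log(‖θ‖ + 2)`. Dichotomy at `d^τ`: a coordinate of degree
`< d^τ` over `ℚ` is repelled by the floor at it (irreducible factor of the clause's polynomial + mean
value theorem, `slot_repulsion`); otherwise both coordinates have degree `≥ d^τ` and the primitive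
measure with `d' = ⌈d^τ⌉` wins (`bookkeeping_one`). [folklore] -/
theorem epiSimultaneousType_of_primitiveApproxMeasure_of_slotFloors {p q C A : ℝ} (hp : 0 ≤ p)
    (hA : 0 < A) (hrace : A * p < A + 1) (hPM : PrimitiveApproxMeasure 2 ![(Real.pi : ℂ), (Real.exp 1 : ℂ)] p q C)
    (hfl : ∀ i : Fin 2, ∃ K C₁ : ℝ, SlotFloor (![(Real.pi : ℂ), (Real.exp 1 : ℂ)] i) A K C₁) : EPiSimultaneousType := by
  choose Kf Cf hKC using hfl
  set τ : ℝ := p / (A + 1) with hτ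
  set a : ℝ := A * p / (A + 1) with ha
  set Kp : ℝ := max (max (Kf 0) (Kf 1)) 0 with hKp
  set b : ℝ := a + |q| + τ * Kp + 3 with hb
  set R : ℝ := ‖![(Real.pi : ℂ), (Real.exp 1 : ℂ)]‖ + 2 with hR
  set C' : ℝ := 3 * (C + Cf 0 + Cf 1) + 5 + Real.log R with hC'
  have hA1 : 0 < A + 1 := by linarith
  have hτ0 : 0 ≤ τ := div_nonneg hp hA1.le
  have ha0 : 0 ≤ a := div_nonneg (mul_nonneg hA.le hp) hA1.le
  have ha1 : a < 1 := by rw [ha, div_lt_one hA1]; exact hrace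
  have hpa : p - τ = a := by rw [hτ, ha]; field_simp; ring
  have hτA : τ * A = a := by rw [hτ, ha]; ring
  have hKp0 : 0 ≤ Kp := le_max_right _ _
  have hτK : 0 ≤ τ * Kp := mul_nonneg hτ0 hKp0
  have hb1 : a + 1 ≤ b := by rw [hb]; linarith [abs_nonneg q]
  have hbq : q ≤ b := by rw [hb]; linarith [le_abs_self q]
  have hbK : τ * Kp ≤ b := by rw [hb]; linarith [abs_nonneg q]
  have hC0 : 0 < C := hPM.1
  have hCf0 : 0 < Cf 0 := (hKC 0).1
  have hCf1 : 0 < Cf 1 := (hKC 1).1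
  have hR1 : 1 ≤ R := by have := norm_nonneg ![(Real.pi : ℂ), (Real.exp 1 : ℂ)]; rw [hR]; linarith
  have hlogR : 0 ≤ Real.log R := Real.log_nonneg hR1
  have hC'pos : 0 < C' := by rw [hC']; linarith
  have hCC' : 2 * C ≤ C' := by rw [hC']; linarith
  have hKall : ∀ i : Fin 2, Kf i ≤ Kp := Fin.forall_fin_two.2
    ⟨(le_max_left _ _).trans (le_max_left _ _), (le_max_right _ _).trans (le_max_left _ _)⟩
  have hCall : ∀ i : Fin 2, 3 * Cf i + 4 + Real.log R ≤ C' := Fin.forall_fin_two.2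
    ⟨by rw [hC']; linarith, by rw [hC']; linarith⟩
  refine ⟨a, b, C', ha1, hC'pos, ?_⟩
  intro d H γ hfr hpoly
  obtain ⟨P₀, hP₀0, hP₀deg, hP₀H, hP₀γ⟩ := hpoly 0
  have hd1 : 1 ≤ d := (natDegree_pos_of_aeval_eq_zero hP₀0 hP₀γ).1.trans_le hP₀deg
  have hH1 : (1 : ℤ) ≤ H :=
    (Int.one_le_abs (leadingCoeff_ne_zero.2 hP₀0)).trans (hP₀H P₀.natDegree)
  have hd1r : (1 : ℝ) ≤ d := by exact_mod_cast hd1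
  have hH1r : (1 : ℝ) ≤ H := by exact_mod_cast hH1
  have hd0 : (0 : ℝ) < d := one_pos.trans_le hd1r
  have hlogH : 0 ≤ Real.log H := Real.log_nonneg hH1r
  have hX0 : 0 ≤ C' * ((d : ℝ) ^ a * Real.log H + (d : ℝ) ^ b) :=
    mul_nonneg hC'pos.le (by linarith [mul_nonneg (Real.rpow_pos_of_pos hd0 a).le hlogH,
      (Real.rpow_pos_of_pos hd0 b).le])
  by_cases hfar : 1 < ‖γ - ![(Real.pi : ℂ), (Real.exp 1 : ℂ)]‖
  · exact le_trans (by rw [Real.exp_le_one_iff]; linarith) hfar.le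
  push Not at hfar
  have hcoord : ∀ j, ‖γ j - ![(Real.pi : ℂ), (Real.exp 1 : ℂ)] j‖ ≤ ‖γ - ![(Real.pi : ℂ), (Real.exp 1 : ℂ)]‖ := fun j => by
    simpa using norm_le_pi_norm (γ - ![(Real.pi : ℂ), (Real.exp 1 : ℂ)]) j
  have hθj : ∀ j, ‖![(Real.pi : ℂ), (Real.exp 1 : ℂ)] j‖ ≤ ‖![(Real.pi : ℂ), (Real.exp 1 : ℂ)]‖ := fun j => norm_le_pi_norm ![(Real.pi : ℂ), (Real.exp 1 : ℂ)] j
  by_cases hsmall : ∃ i : Fin 2, ((minpoly ℚ (γ i)).natDegree : ℝ) < (d : ℝ) ^ τ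
  · -- SEMI-ENTANGLED CASE: a coordinate of small degree (large index) — floor at it + mean value
    obtain ⟨i, hi⟩ := hsmall
    obtain ⟨P, hP0, hPdeg, hPH, hPγ⟩ := hpoly i
    have hξR : ‖![(Real.pi : ℂ), (Real.exp 1 : ℂ)] i‖ ≤ R := by have := hθj i; rw [hR]; linarith
    have hαR : ‖γ i‖ ≤ R := by
      linarith [hcoord i, hθj i, norm_sub_norm_le (γ i) (![(Real.pi : ℂ), (Real.exp 1 : ℂ)] i)]
    have hrep := slot_repulsion (hKC i) hA (hKall i) hKp0 hP0 hPdeg hPH hPγ hi.le hd1r hH1r hR1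
      hξR hαR
    have hbk := bookkeeping_two (hKC i).1 (hCall i) hlogR hd1r hlogH hτA ha0 hb1 hbK
      (A := A) (Kp := Kp) (d := (d : ℝ))
    have hmul : Real.exp ((4 + Real.log R) * d + Real.log H) *
        Real.exp (-(C' * ((d : ℝ) ^ a * Real.log H + (d : ℝ) ^ b))) ≤
        Real.exp ((4 + Real.log R) * d + Real.log H) * ‖γ i - ![(Real.pi : ℂ), (Real.exp 1 : ℂ)] i‖ := by
      rw [← Real.exp_add]
      exact le_trans (Real.exp_le_exp.2 (by linarith)) hrep
    exact (le_of_mul_le_mul_left hmul (Real.exp_pos _)).trans (hcoord i)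
  · -- CORE-TYPE CASE: both coordinates of degree `≥ d^τ` (index `≤ d^{1−τ}`) — the pair measure
    push Not at hsmall
    have hkey := hPM.2 d ⌈(d : ℝ) ^ τ⌉₊ H γ
      (Nat.one_le_ceil_iff.2 (Real.rpow_pos_of_pos hd0 _)) hfr (fun i => Nat.ceil_le.2 (hsmall i))
      hpoly
    have hbk := bookkeeping_one hC0 hCC' hd1r hlogH (Nat.le_ceil ((d : ℝ) ^ τ)) hpa hb1 hbq
      (q := q)
    exact le_trans (Real.exp_le_exp.2 (by linarith)) hkey

/-- **Pair measure + floors ⟹ `EPiSimultaneousType`**, with the pair measure in its native form: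
a decoupled codimension-one measure of algebraic independence of `(π, e)` with total-degree exponent
`μ` (and height-free exponent `K ≥ 0`) and slot floors with exponent `A ≥ 1` at `π` and at `e` give
the crux as soon as `A(μ − 1) < 2` (`p = (μ+1)/2`, `A·p < A + 1`). So ANY saving `μ < 3` on the
pair side is paid for by type `A < 2/(μ−1)` on the single-variable side. [folklore] -/
theorem epiSimultaneousType_of_codimOneMeasure_of_slotFloors {μ K C A : ℝ} (hμ : 0 ≤ μ)
    (hK : 0 ≤ K) (hA : 1 ≤ A) (hrace : A * (μ - 1) < 2) (hP : CodimOneMeasure 2 ![(Real.pi : ℂ), (Real.exp 1 : ℂ)] μ K C)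
    (hπ : ∃ K₀ C₀ : ℝ, SlotFloor (Real.pi : ℂ) A K₀ C₀)
    (he : ∃ K₁ C₁ : ℝ, SlotFloor (Real.exp 1 : ℂ) A K₁ C₁) : EPiSimultaneousType := by
  obtain ⟨q, C', -, hPM⟩ := primitive_of_codimOneMeasure hμ hK hP
  have hp : (0 : ℝ) ≤ (μ + 1) / 2 := by positivity
  have hA0 : 0 < A := by linarith
  have hrace' : A * ((μ + 1) / 2) < A + 1 := by nlinarith
  refine epiSimultaneousType_of_primitiveApproxMeasure_of_slotFloors hp hA0 hrace' hPM ?_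
  exact Fin.forall_fin_two.2 ⟨by simpa using hπ, by simpa using he⟩

/-- **The registered composition of line `bounded-index-core`** (`C⁺ ⟹ crux`, kernel-checked): the
three stub statements of `Lines/bounded-index-core.lean`, taken as hypotheses — `hpair` =
`stub_pairMeasure` (a pair measure for `(π, e)` with SOME `μ < 3`; OPEN, it contains `e ⊥ π`),
`he` = `stub_eFloor` (floor at `e` for every `A > 1`; OPEN below `A = 2`), `hπ` = `stub_piFloor`
(floor at `π` for every `A > 1`; Nesterenko–Waldschmidt 1996 Thm 2(2), KNOWN) — give
`EPiSimultaneousType`: take `A = 1 + (3 − μ)/4`, then `A(μ − 1) < 2`. [folklore] -/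
theorem epiSimultaneousType_of_inputs :
    (∃ μ K C : ℝ, 0 ≤ μ ∧ μ < 3 ∧ 0 ≤ K ∧ CodimOneMeasure 2 ![(Real.pi : ℂ), (Real.exp 1 : ℂ)] μ K C) →
    (∀ A : ℝ, 1 < A → ∃ K C : ℝ, SlotFloor (Real.exp 1 : ℂ) A K C) →
    (∀ A : ℝ, 1 < A → ∃ K C : ℝ, SlotFloor (Real.pi : ℂ) A K C) → EPiSimultaneousType := by
  rintro ⟨μ, K, C, hμ0, hμ3, hK, hC⟩ he hπ
  set A : ℝ := 1 + (3 - μ) / 4 with hA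
  have hA1 : 1 < A := by rw [hA]; linarith
  have hrace : A * (μ - 1) < 2 := by
    rw [hA]; nlinarith [mul_pos (show (0 : ℝ) < 3 - μ by linarith) (show (0 : ℝ) < 5 - μ by linarith)]
  exact epiSimultaneousType_of_codimOneMeasure_of_slotFloors hμ0 hK hA1.le hrace hC (hπ A hA1)
    (he A hA1)

/-- **The exchange curve, other end**: an OPTIMAL-exponent pair measure (`μ = 2 + o(1)`, the generic
truth: here `∀ μ > 2`) needs only SOME saving `A < 2` on the `e`-side (and floors at `π` for all
`A > 1`) — choose `μ = 2 + (2 − A)/(2A)`, so `A(μ − 1) = A + (2 − A)/2 < 2`. [folklore] -/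
theorem epiSimultaneousType_of_optimalPair_of_eSaving
    (hpair : ∀ μ : ℝ, 2 < μ → ∃ K C : ℝ, 0 ≤ K ∧ CodimOneMeasure 2 ![(Real.pi : ℂ), (Real.exp 1 : ℂ)] μ K C)
    (he : ∃ A : ℝ, 1 < A ∧ A < 2 ∧ ∃ K C : ℝ, SlotFloor (Real.exp 1 : ℂ) A K C)
    (hπ : ∀ A : ℝ, 1 < A → ∃ K C : ℝ, SlotFloor (Real.pi : ℂ) A K C) : EPiSimultaneousType := by
  obtain ⟨A, hA1, hA2, heA⟩ := he
  have hA0 : 0 < A := by linarith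
  set μ : ℝ := 2 + (2 - A) / (2 * A) with hμ
  have hμ2 : 2 < μ := by
    have h' : 0 < (2 - A) / (2 * A) := div_pos (by linarith) (by linarith)
    rw [hμ]; linarith
  have hrace : A * (μ - 1) < 2 := by
    rw [hμ]
    have h1 : A * (2 + (2 - A) / (2 * A) - 1) = A + (2 - A) / 2 := by field_simp; ring
    rw [h1]; linarith
  obtain ⟨K, C, hK, hC⟩ := hpair μ hμ2
  exact epiSimultaneousType_of_codimOneMeasure_of_slotFloors (by linarith) hK hA1.le hrace hC
    (hπ A hA1) heA

/-- Core bookkeeping (pure real arithmetic): with `1 ≤ r ≤ d`, `r/M ≤ d'`, `L' ≤ 3d + L`,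
`C(r^p (L' + r)/d' + r^q) ≤ C(4M+1)(d^{p−1} L + d^{max p q})`. [folklore] -/
theorem bookkeeping_core {C p q M d r d' L L' : ℝ} (hC : 0 < C) (hM : 1 ≤ M) (hp : 1 ≤ p)
    (hq : 0 ≤ q) (hd : 1 ≤ d) (hr1 : 1 ≤ r) (hrd : r ≤ d) (hd' : r / M ≤ d') (hL : 0 ≤ L)
    (hL'0 : 0 ≤ L') (hL' : L' ≤ 3 * d + L) :
    C * (r ^ p * (L' + r) / d' + r ^ q) ≤ C * (4 * M + 1) * (d ^ (p - 1) * L + d ^ max p q) := by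
  have hr0 : 0 < r := one_pos.trans_le hr1
  have hd0 : 0 < d := one_pos.trans_le hd
  have hM0 : 0 < M := one_pos.trans_le hM
  have hrM : 0 < r / M := div_pos hr0 hM0
  have hrp0 : 0 ≤ r ^ p := (Real.rpow_pos_of_pos hr0 p).le
  have hrp1 : 0 ≤ r ^ (p - 1) := (Real.rpow_pos_of_pos hr0 _).le
  have hdp1 : 0 ≤ d ^ (p - 1) := (Real.rpow_pos_of_pos hd0 _).le
  have hdm : 0 ≤ d ^ max p q := (Real.rpow_pos_of_pos hd0 _).le
  have e1 : r ^ p / d' ≤ M * r ^ (p - 1) := by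
    calc r ^ p / d' ≤ r ^ p / (r / M) := div_le_div_of_nonneg_left hrp0 hrM hd'
      _ = M * r ^ (p - 1) := by rw [Real.rpow_sub_one hr0.ne']; field_simp
  have e2 : L' + r ≤ L + 4 * d := by linarith
  have e3 : r ^ (p - 1) ≤ d ^ (p - 1) := Real.rpow_le_rpow hr0.le hrd (by linarith)
  have e4 : d ^ (p - 1) * d = d ^ p := by rw [Real.rpow_sub_one hd0.ne']; field_simp
  have e5 : d ^ p ≤ d ^ max p q := Real.rpow_le_rpow_of_exponent_le hd (le_max_left _ _)
  have e6 : r ^ q ≤ d ^ max p q :=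
    (Real.rpow_le_rpow hr0.le hrd hq).trans (Real.rpow_le_rpow_of_exponent_le hd (le_max_right _ _))
  have f1 : r ^ p * (L' + r) / d' = (r ^ p / d') * (L' + r) := by ring
  have f2 : (r ^ p / d') * (L' + r) ≤ (M * r ^ (p - 1)) * (L + 4 * d) :=
    mul_le_mul e1 e2 (by linarith) (mul_nonneg hM0.le hrp1)
  have f3 : M * r ^ (p - 1) * L ≤ M * d ^ (p - 1) * L :=
    mul_le_mul_of_nonneg_right (mul_le_mul_of_nonneg_left e3 hM0.le) hL
  have f4 : M * r ^ (p - 1) * d ≤ M * d ^ max p q := by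
    calc M * r ^ (p - 1) * d ≤ M * d ^ (p - 1) * d :=
          mul_le_mul_of_nonneg_right (mul_le_mul_of_nonneg_left e3 hM0.le) hd0.le
      _ = M * d ^ p := by rw [mul_assoc, e4]
      _ ≤ M * d ^ max p q := mul_le_mul_of_nonneg_left e5 hM0.le
  have t1 : r ^ p * (L' + r) / d' ≤ M * d ^ (p - 1) * L + 4 * (M * d ^ max p q) := by
    rw [f1]
    calc (r ^ p / d') * (L' + r) ≤ (M * r ^ (p - 1)) * (L + 4 * d) := f2
      _ = M * r ^ (p - 1) * L + 4 * (M * r ^ (p - 1) * d) := by ring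
      _ ≤ M * d ^ (p - 1) * L + 4 * (M * d ^ max p q) := by linarith
  have hX : 0 ≤ d ^ (p - 1) * L := mul_nonneg hdp1 hL
  have key : r ^ p * (L' + r) / d' + r ^ q ≤ (4 * M + 1) * (d ^ (p - 1) * L + d ^ max p q) := by
    nlinarith [mul_nonneg hM0.le hX, mul_nonneg hM0.le hdm]
  calc C * (r ^ p * (L' + r) / d' + r ^ q)
      ≤ C * ((4 * M + 1) * (d ^ (p - 1) * L + d ^ max p q)) := mul_le_mul_of_nonneg_left key hC.le
    _ = C * (4 * M + 1) * (d ^ (p - 1) * L + d ^ max p q) := by ring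

/-- **Exchange rate on the bounded-index core.** A primitive approximation measure at `(π, e)` with
exponents `(p, q)`, `p ≥ 1`, `q ≥ 0`, gives, for every index bound `M ≥ 1`, the crux inequality with
parameters `(p − 1, max p q, C(4M+1))` on every admissible challenger `γ` of ENTANGLEMENT INDEX `≤ M`,
i.e. `[ℚ(γ₁, γ₂):ℚ] ≤ M · [ℚ(γᵢ):ℚ]` for `i = 0, 1`. Proof: normalise the level to
`r = [ℚ(γ):ℚ] ≤ d` (irreducible witnesses of exact degree `≤ r` and height `≤ 8^d H`,
`EPiSimultaneousType.clause_irreducible`), take `d' = ⌈r/M⌉ ≤ deg_ℚ γᵢ`, apply the measure at level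
`r`, and book-keep `C(r^p(log H + 3d + r)·M/r + r^q) ≤ C(4M+1)(d^{p−1} log H + d^{max p q})`.
An algebraic point of an irreducible curve `Q = 0` over `ℚ` has index `≤ deg Q`, which is why the
route's race `EPiRace` only meets this population (line card `Ideas/bounded-index-core.md`).
[folklore] -/
theorem core_of_primitiveApproxMeasure {p q C : ℝ} (hp : 1 ≤ p) (hq : 0 ≤ q)
    (hPM : PrimitiveApproxMeasure 2 ![(Real.pi : ℂ), (Real.exp 1 : ℂ)] p q C) {M : ℕ} (hM : 1 ≤ M) (d H : ℕ) (γ : Fin 2 → ℂ)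
    (hfr : Module.finrank ℚ ↥(IntermediateField.adjoin ℚ (Set.range γ)) ≤ d)
    (hpoly : ∀ i, ∃ P : Polynomial ℤ, P ≠ 0 ∧ P.natDegree ≤ d ∧ (∀ k, |P.coeff k| ≤ (H : ℤ)) ∧
      Polynomial.aeval (γ i) P = 0)
    (hidx : ∀ i, Module.finrank ℚ ↥(IntermediateField.adjoin ℚ (Set.range γ)) ≤
      M * (minpoly ℚ (γ i)).natDegree) :
    Real.exp (-(C * (4 * (M : ℝ) + 1) * ((d : ℝ) ^ (p - 1) * Real.log H + (d : ℝ) ^ max p q)))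
      ≤ ‖γ - ![(Real.pi : ℂ), (Real.exp 1 : ℂ)]‖ := by
  have hint : ∀ i, IsIntegral ℚ (γ i) := fun i => by
    obtain ⟨P, hP0, -, -, hPz⟩ := hpoly i
    exact (natDegree_pos_of_aeval_eq_zero hP0 hPz).2
  obtain ⟨P₀, hP₀0, hP₀deg, hP₀H, hP₀γ⟩ := hpoly 0
  have hd1 : 1 ≤ d := (natDegree_pos_of_aeval_eq_zero hP₀0 hP₀γ).1.trans_le hP₀deg
  have hH1 : (1 : ℤ) ≤ H :=
    (Int.one_le_abs (leadingCoeff_ne_zero.2 hP₀0)).trans (hP₀H P₀.natDegree)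
  have hd1r : (1 : ℝ) ≤ d := by exact_mod_cast hd1
  have hH1r : (1 : ℝ) ≤ H := by exact_mod_cast hH1
  haveI hfd : FiniteDimensional ℚ ↥(IntermediateField.adjoin ℚ (Set.range γ)) :=
    IntermediateField.finiteDimensional_adjoin (fun x hx => by
      obtain ⟨j, rfl⟩ := hx
      exact hint j)
  -- the normalised level `r = [ℚ(γ):ℚ]`, `1 ≤ r ≤ d`
  set r : ℕ := Module.finrank ℚ ↥(IntermediateField.adjoin ℚ (Set.range γ)) with hr
  have hr1 : 1 ≤ r := Module.finrank_pos
  have hrd : r ≤ d := hfr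
  have hcoord : ∀ i, (minpoly ℚ (γ i)).natDegree ≤ r := fun i => by
    rw [hr, ← IntermediateField.adjoin.finrank (hint i)]
    exact IntermediateField.finrank_le_of_le_right
      (IntermediateField.adjoin.mono ℚ _ _ (Set.singleton_subset_iff.2 ⟨i, rfl⟩))
  -- irreducible witnesses at level `r`, height `8^d H`
  have hpoly' : ∀ i, ∃ Q : Polynomial ℤ, Q ≠ 0 ∧ Q.natDegree ≤ r ∧
      (∀ k, |Q.coeff k| ≤ ((8 ^ d * H : ℕ) : ℤ)) ∧ Polynomial.aeval (γ i) Q = 0 := fun i => by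
    obtain ⟨Q, hQirr, hQdeg, -, hQH, hQγ⟩ := EPiSimultaneousType.clause_irreducible (hpoly i)
    refine ⟨Q, hQirr.ne_zero, ?_, hQH, hQγ⟩
    rw [hQdeg, IntermediateField.adjoin.finrank (hint i)]
    exact hcoord i
  -- `d' = ⌈r/M⌉ ≤ dᵢ` by the index bound
  have hM0 : (0 : ℝ) < M := by exact_mod_cast hM
  have hr1r : (1 : ℝ) ≤ r := by exact_mod_cast hr1
  have hrdr : (r : ℝ) ≤ d := by exact_mod_cast hrd
  set d' : ℕ := ⌈(r : ℝ) / M⌉₊ with hd'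
  have hd'1 : 1 ≤ d' := Nat.one_le_ceil_iff.2 (div_pos (by linarith) hM0)
  have hd'le : ∀ i, d' ≤ (minpoly ℚ (γ i)).natDegree := fun i => by
    refine Nat.ceil_le.2 ?_
    rw [div_le_iff₀ hM0]
    have h' : (r : ℝ) ≤ (M : ℝ) * ((minpoly ℚ (γ i)).natDegree : ℝ) := by exact_mod_cast hidx i
    simpa [mul_comm] using h'
  have hkey := hPM.2 r d' (8 ^ d * H) γ hd'1 le_rfl hd'le hpoly'
  refine le_trans (Real.exp_le_exp.2 (neg_le_neg ?_)) hkey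
  -- bookkeeping
  have hL'eq : Real.log ((8 ^ d * H : ℕ) : ℝ) = d * Real.log 8 + Real.log H := by
    push_cast
    rw [Real.log_mul (by positivity) (by positivity), Real.log_pow]
  have hL'0 : 0 ≤ Real.log ((8 ^ d * H : ℕ) : ℝ) := Real.log_natCast_nonneg _
  have hL' : Real.log ((8 ^ d * H : ℕ) : ℝ) ≤ 3 * d + Real.log H := by
    rw [hL'eq]
    have hl8 : Real.log 8 ≤ 3 := by
      rw [Real.log_le_iff_le_exp (by norm_num)]
      have h2 : (2 : ℝ) ≤ Real.exp 1 := by linarith [Real.add_one_le_exp (1 : ℝ)]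
      calc (8 : ℝ) = 2 ^ 3 := by norm_num
        _ ≤ (Real.exp 1) ^ 3 := pow_le_pow_left₀ (by norm_num) h2 3
        _ = Real.exp 3 := by rw [← Real.exp_nat_mul]; norm_num
    nlinarith
  exact bookkeeping_core hPM.1 (by exact_mod_cast hM) hp hq hd1r hr1r hrdr (Nat.le_ceil _)
    (Real.log_nonneg hH1r) hL'0 hL'

/-- **The core from the pair measure alone** (the line's first lemma, fully proved since
`CodimOneTransfer` landed): a decoupled codimension-one measure of algebraic independence of `(π, e)`
with exponents `(μ, K)`, `μ ≥ 1`, `K ≥ 0`, gives, for EVERY index bound `M ≥ 1`, the crux inequality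
with degree exponent `a = (μ − 1)/2` (and some `b`, `C' > 0`) on all admissible challengers of
entanglement index `≤ M`. So ANY `μ < 3` yields SOME `a < 1` on every core; Dirichlet's `μ ≥ 2` maps to
the Disproof's floor `a ≥ 1/2`, the generic `μ = 2 + 2η` to `a = 1/2 + η`. No `e`-floor, no slot
dichotomy. [folklore] -/
theorem core_of_codimOneMeasure {μ K C : ℝ} (hμ : 1 ≤ μ) (hK : 0 ≤ K)
    (h : CodimOneMeasure 2 ![(Real.pi : ℂ), (Real.exp 1 : ℂ)] μ K C) {M : ℕ} (hM : 1 ≤ M) :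
    ∃ b C' : ℝ, 0 < C' ∧ ∀ (d H : ℕ) (γ : Fin 2 → ℂ),
      Module.finrank ℚ ↥(IntermediateField.adjoin ℚ (Set.range γ)) ≤ d →
      (∀ i, ∃ P : Polynomial ℤ, P ≠ 0 ∧ P.natDegree ≤ d ∧ (∀ k, |P.coeff k| ≤ (H : ℤ)) ∧
        Polynomial.aeval (γ i) P = 0) →
      (∀ i, Module.finrank ℚ ↥(IntermediateField.adjoin ℚ (Set.range γ)) ≤
        M * (minpoly ℚ (γ i)).natDegree) →
      Real.exp (-(C' * ((d : ℝ) ^ ((μ - 1) / 2) * Real.log H + (d : ℝ) ^ b))) ≤ ‖γ - ![(Real.pi : ℂ), (Real.exp 1 : ℂ)]‖ := by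
  obtain ⟨q, C', hq, hPM⟩ := primitive_of_codimOneMeasure (by linarith) hK h
  have hp : (1 : ℝ) ≤ (μ + 1) / 2 := by linarith
  have he : (μ + 1) / 2 - 1 = (μ - 1) / 2 := by ring
  refine ⟨max ((μ + 1) / 2) q, C' * (4 * (M : ℝ) + 1), mul_pos hPM.1 (by positivity),
    fun d H γ hfr hpoly hidx => ?_⟩
  have := core_of_primitiveApproxMeasure hp hq hPM hM d H γ hfr hpoly hidx
  rwa [he] at this

end EPiSimultaneousType.BoundedIndexCore

end Summit.Schanuel.Schanuel.Theorems

end
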